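import Summits.HodgeConjecture.HodgeConjecture.Theorems.SplitImpliesAllTypeIIAnchorAtMembers
import Literature.AlgebraicGeometry.HodgeTheory.WeilTypeIIGenericFibreSimple
import Literature.AlgebraicGeometry.HodgeTheory.WeilTypeIIGenericFibreSimpleOfNonsplit
import Literature.AlgebraicGeometry.VanGeemen1994.WeilDiscriminantOfHyperbolic
import HarnessLib

/-!
# `SplitImpliesAll` — the GENERIC SIMPLE type-II member of a non-split cell is an ANCHORED FIBRE of Deligne's family, BY NAME (modulo J1)

SUPPORT file for item stmt-HodgeConjecture-19149 (`SplitImpliesAll.NonsplitSixfoldCells`, K1), cell `vhodge`, seat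
`vhodge-typer-1` gen 8 (director-hodge g7, vhodge/INBOX 2026-08-27T03:52:41Z (1): «OPTIONAL second and LAST item: g7's
HANDOFF (a) "generic simple type-II anchor packaging" (TYPER1-g6-LANDED §How, ≈ 60 l., Summits-side via the filer) IF still
unlanded and still by-name over p484441 ∕ p485711»; tree read 04:0xZ: the Literature theorems
`exists_simple_typeII_generic_fibre_of_periodConstructionAtWeilType_of_nonsplit` (p485711) and
`exists_simple_generic_fibre_firstSixfoldCell_of_periodConstructionAtWeilType` (p484441) have NO Summits consumer — unlanded).

WHAT IT PACKAGES (memo ROUTE-P3-g17 §3 (b)–(c), director's words of record «pointedness at a GENERIC simple type-II member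
is not given — needs J1-5U + Riemann fullness + g2's handle»; TYPER1-g6-LANDED §«How the route reads them»): the two halves
that the tree holds separately —
* FIBRE EXISTENCE (Literature, vhodge-typer-1 g6, p481862 → p485711): granted J1
  (`deligne1982_weilFamily_periodConstructionAtWeilType`, Deligne 1982 §4 proof of Thm. 4.8 with van Geemen 5.3–5.5; an
  UNPROVED named fact, a HYPOTHESIS here), Deligne's family through ANY Weil-type member `(P, ψ₀, h_K(e,a))` of a NON-SPLIT
  cell `(n, d, [u])` (`n` odd, `u < 0`, `[u] ≠ [-1]`) has a fibre `Y_s` which is a SIMPLE abelian `2n`-fold with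
  `End⁰(Y_s) ≃ₐ[ℚ] (-d, -u)_ℚ = D_{[u]}`, carrying `ψ` with `Ψ_s ψ = -ψ Ψ_s`, `ψ² = c·𝟙`, `c = r²(-u) > 0`
  (Shimura 1963 §4 type II; van Geemen 6.11; Mumford §19);
* ANCHORING (Theorems, vhodge-typer-1 g2 → p449824, FACT-FREE): every member carrying such a `ψ` is an
  `antiCompatibleAnchor`-ed fibre ON ITS OWN CHART (`SplitImpliesAllTypeIIAnchorAtMembers.antiCompatibleAnchor_of_anticomm`:
  Moonen–Zarhin's second criterion, Lefschetz `(1,1)`, the Kähler sign);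
— into ONE by-name statement per scope: §1 `antiCompatibleAnchor_of_chart_of_anticomm` (chart transport of the g2 handle to a
fibre `X ≅ A.X` of any family, fact-free); §2 `exists_simple_generic_anchoredFibre_of_periodConstructionAtWeilType_of_nonsplit`
(J1 ⊢ on EVERY non-split right-sign cell `(n, d, [u])`, `n` odd: Deligne's family through any member has a fibre `𝒳_s` which
is SIMPLE with `End⁰ ≃ₐ D_{[u]}` AND at which EVERY class restricting into the fibre's Weil plane is
`antiCompatibleAnchor n d 𝒳_s`-anchored — the K1 anchor predicate of `Theorems/SplitImpliesAllTypeIIAnchorGerm`, verbatim);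
§3 `exists_simple_generic_anchoredFibre_firstSixfoldCell_of_periodConstructionAtWeilType` (the FIRST CELL
`(ℚ(√-3), 6, [-2])`, `D₆ = (-3, 2)_ℚ`, spelled out over p484441).

HONEST LABEL. J1 is a hypothesis, never asserted; nothing here proves a case of the Hodge conjecture, `W₆`, `HC_AV`, HC or
K1; `HC_CM` ∕ Markman occur nowhere; no `def`, no named fact, 0 sorries; theorems only. WHAT THIS IS NOT: it is NOT
`PointedWeilFamiliesComponent n d δ (antiCompatibleAnchor n d)` with the generic fibre as the marked point — that was landed
modulo J1 with the CM point of the type-II locus as anchor fibre (`SplitImpliesAllTypeIIPointedOfJ1.typeIIPointed_of_J1`,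
p430511); re-running the reach package to END at this generic fibre would need its discriminant chart BY NAME (the fibre's
`HasWeilDiscriminantNondeg … [u]` witness is not among J1's clauses) — not claimed. The research content of K1 (L₆, the
germ at the anchored fibre) is untouched; this file only makes «the generic simple type-II member, anchored» citable by name.

References: [Deligne1982HodgeCycles] §4 Prop. 4.4, proof of Thm. 4.8; [Shimura1963AnalyticFamilies] §4; [vanGeemen1994HodgeAV]
4.14, 5.3–5.8, Thm. 6.11–6.12; [MoonenZarhin1998WeilClasses] §2; [MumfordAV1970] §19 Cor. 2; [VignerasLNM800] I §2 Cor. 2.4;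
[vanGeemenVerra2003QuaternionicPryms] §4 (abelian sixfolds with `D₆`).
-/

set_option linter.dupNamespace false

open CategoryTheory
open scoped Quaternion
open Literature.AlgebraicGeometry Literature.AlgebraicGeometry.Motives
open Literature.AlgebraicGeometry.HodgeTheory
open Literature.AlgebraicTopology.SingularHomology
open Literature.AlgebraicGeometry.VanGeemen1994
open Summit.HodgeConjecture.HodgeConjecture.Theorems.SplitImpliesAllTypeIIAnchorGerm
open Summit.HodgeConjecture.HodgeConjecture.Theorems.SplitImpliesAllTypeIIAnchorAtMembers

namespace Summit.HodgeConjecture.HodgeConjecture.Theorems.SplitImpliesAllTypeIIGenericAnchor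

variable {n d : ℕ}

/-! ## §1 Chart transport of the g2 handle (fact-free) -/

/-- **A fibre charted by an abelian `2n`-fold carrying an anticommuting `ψ` (`φψ = -ψφ`, `ψ² = b ≥ 1`) is an
`antiCompatibleAnchor`-ed fibre for every class restricting into the chart's Weil plane — FACT-FREE.** The g2 handle
`antiCompatibleAnchor_of_anticomm` anchors the class on the chart `A` itself (with `(e, a)` any projective embedding of
`A` and any rational generator of `H²(ℙ^{e.n})`, supplied by `VanGeemen1994.exists_projectiveEmbedding_hasWeilDiscriminantNondeg`);
composing its chart with `ε : A.X ≅ X` transports the anchor to the fibre `X` (`(ι₀ ≫ ε)^* = ι₀^* ∘ ε^*`).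
[cite: MoonenZarhin1998WeilClasses, §2] [cite: vanGeemen1994HodgeAV, 4.9 and Lemma 5.2 (1)–(2)] -/
theorem antiCompatibleAnchor_of_chart_of_anticomm (hn : 0 < n) (hd : 0 < d) {A : AbelianVariety ℂ}
    {φ ψ : A ⟶ A} {b : ℕ} (hA : A.dim = 2 * n) (hφ : φ ≫ φ = -(d • 𝟙 A)) (hφψ : φ ≫ ψ = -(ψ ≫ φ))
    (hψ : ψ ≫ ψ = b • 𝟙 A) (hb : 0 < b) {X : SchemeOver ℂ} (ε : A.X ≅ X) {x : complexBetti X (2 * n)}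
    (hx : complexBetti.map ε.hom (2 * n) x ∈ weilClassesOf A φ n d) :
    antiCompatibleAnchor n d X x := by
  obtain ⟨e, a, -, ha, ha0, -⟩ := exists_projectiveEmbedding_hasWeilDiscriminantNondeg hn hA hd hφ
  obtain ⟨A₀, φ₀, ι₀, hA₀, hφ₀, hmem, y, hyalg, hy, htop⟩ :=
    antiCompatibleAnchor_of_anticomm hn hA hd hφ hφψ hψ hb e ha ha0 hx
  refine ⟨A₀, φ₀, ι₀ ≪≫ ε, hA₀, hφ₀, ?_, y, hyalg, hy, htop⟩
  rw [Iso.trans_hom, complexBetti.map_comp, ModuleCat.comp_apply]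
  exact hmem

/-! ## §2 Every non-split right-sign cell `(n, d, [u])`, `n` odd: the simple generic fibre, anchored (modulo J1) -/

/-- **THE GENERIC SIMPLE TYPE-II MEMBER OF A NON-SPLIT CELL IS AN ANCHORED FIBRE OF DELIGNE'S FAMILY, MODULO J1.**
Granted J1: for every odd `n`, `d ≥ 1`, and every abelian `2n`-fold `(P, ψ₀, h_K(e,a))` of Weil type `(n, n)` over
`ℚ(√-d)` with a non-degenerate discriminant witness of class `[u]`, `u < 0`, `[u] ≠ [-1]` (a NON-SPLIT cell), Deligne's
level family `f : 𝒳 → S` through `P` (all the clauses of the Literature theorem, verbatim) has a fibre `𝒳_s ≅ Y_s` such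
that (i) `Y_s` is a SIMPLE abelian variety with `End⁰(Y_s) ≃ₐ[ℚ] (-d, -u)_ℚ` carrying `ψ`, `Ψ_s ψ = -ψ Ψ_s`,
`ψ² = c·𝟙`, `c = r²(-u) > 0`, AND (ii) every class `x ∈ H^{2n}(𝒳_s)` whose chart value lies in the Weil plane
`weilClassesOf Y_s Ψ_s n d` satisfies `antiCompatibleAnchor n d 𝒳_s x` — the K1 anchor predicate. (i) is
`exists_simple_typeII_generic_fibre_of_periodConstructionAtWeilType_of_nonsplit` (p485711) BY NAME; (ii) is §1 at that
fibre. For `n = 3`: on EVERY non-split sixfold cell of the right sign — the whole scope of K1.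
[cite: Deligne1982HodgeCycles, §4 Prop. 4.4 and proof of Thm. 4.8] [cite: Shimura1963AnalyticFamilies, §4 (Type II)]
[cite: vanGeemen1994HodgeAV, 4.14, 5.3–5.8 and proof of Thm. 6.11] [cite: MoonenZarhin1998WeilClasses, §2]
[cite: MumfordAV1970, §19 Cor. 2 of Thm. 1] [cite: VignerasLNM800, Ch. I §2 Cor. 2.4] -/
theorem exists_simple_generic_anchoredFibre_of_periodConstructionAtWeilType_of_nonsplit
    (hJ : deligne1982_weilFamily_periodConstructionAtWeilType) (hodd : Odd n) (hd : 1 ≤ d)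
    {P : AbelianVariety ℂ} {ψ₀ : P ⟶ P} (hWT : IsWeilType P ψ₀ n d)
    (e : ProjectiveEmbedding P.X) {a : complexBetti (projectiveSpace e.n ℂ) 2}
    (ha : IsRationalClass a) (ha0 : a ≠ 0) (u : ℚˣ) (hu : (u : ℚ) < 0)
    (hδ : (QuotientGroup.mk u : weilNormResidueGroup d) ≠ QuotientGroup.mk (-1))
    (hδP : HasWeilDiscriminantNondeg P ψ₀ n d
      ((d : ℂ) • complexBetti.map e.ι 2 a + complexBetti.map ψ₀.hom.hom.hom 2 (complexBetti.map e.ι 2 a))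
      (QuotientGroup.mk u)) :
    ∃ (𝒳 S : SchemeOver ℂ) (f : 𝒳 ⟶ S) (g : 𝒳 ⟶ 𝒳) (s₀ : ComplexPoints S)
      (e' : P.X ≅ fiberOver f s₀)
      (Y : ComplexPoints S → AbelianVariety ℂ) (Ψ : ∀ s, Y s ⟶ Y s)
      (ε : ∀ s, (Y s).X ≅ fiberOver f s) (N : ℕ)
      (ι : 𝒳 ⟶ CategoryTheory.MonoidalCategoryStruct.tensorObj (projectiveSpace N ℂ) S)
      (a' : complexBetti (projectiveSpace N ℂ) 2),
      IsSmoothProjectiveFamily f (2 * n) ∧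
      AlgebraicGeometry.IsClosedImmersion ι.left ∧
      ι ≫ CategoryTheory.CartesianMonoidalCategory.snd (projectiveSpace N ℂ) S = f ∧
      IrreducibleSpace S.left ∧ AlgebraicGeometry.Smooth S.hom ∧ IsQuasiProjectiveOver S ∧
      g ≫ f = f ∧
      (e'.hom ≫ fiberι f s₀) ≫ g = ψ₀.hom.hom.hom ≫ (e'.hom ≫ fiberι f s₀) ∧
      (∀ s, (Y s).dim = 2 * n ∧ Ψ s ≫ Ψ s = -((d : ℤ) • 𝟙 (Y s)) ∧
        ((ε s).hom ≫ fiberι f s) ≫ g = (Ψ s).hom.hom.hom ≫ ((ε s).hom ≫ fiberι f s)) ∧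
      IsRationalClass a' ∧
      complexBetti.map e'.hom 2 (complexBetti.map (fiberι f s₀) 2
        (complexBetti.map
          (ι ≫ CategoryTheory.CartesianMonoidalCategory.fst (projectiveSpace N ℂ) S) 2 a')) =
        (d : ℂ) • complexBetti.map e.ι 2 a +
          complexBetti.map ψ₀.hom.hom.hom 2 (complexBetti.map e.ι 2 a) ∧
      ∃ (s : ComplexPoints S) (ψ : Y s ⟶ Y s) (c : ℕ), 0 < c ∧ Ψ s ≫ ψ = -(ψ ≫ Ψ s) ∧
        ψ ≫ ψ = c • 𝟙 (Y s) ∧ (∃ r : ℚ, r ≠ 0 ∧ (c : ℚ) = r ^ 2 * (-(u : ℚ))) ∧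
        Nonempty ((Y s).endAlgebra ≃ₐ[ℚ] ℍ[ℚ,-(d : ℚ),-(u : ℚ)]) ∧ AbelianVariety.IsSimple (Y s) ∧
        ∀ x : complexBetti (fiberOver f s) (2 * n),
          complexBetti.map (ε s).hom (2 * n) x ∈ weilClassesOf (Y s) (Ψ s) n d →
            antiCompatibleAnchor n d (fiberOver f s) x := by
  obtain ⟨𝒳, S, f, g, s₀, e', Y, Ψ, ε, N, ι, a', hfam, hιcl, hιf, hirr, hsm, hqp, hgf, hge', hY, ha'r, ha'pol,
    s, ψ, c, hc, hanti, hsq, hr, hEnd, hsimple⟩ :=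
    exists_simple_typeII_generic_fibre_of_periodConstructionAtWeilType_of_nonsplit hJ hodd hd hWT e ha ha0 u hu
      hδ hδP
  have hn : 0 < n := by obtain ⟨m, hm⟩ := hodd; omega
  have hd0 : 0 < d := hd
  have hΨs : Ψ s ≫ Ψ s = -(d • 𝟙 (Y s)) := by rw [(hY s).2.1, natCast_zsmul]
  exact ⟨𝒳, S, f, g, s₀, e', Y, Ψ, ε, N, ι, a', hfam, hιcl, hιf, hirr, hsm, hqp, hgf, hge', hY, ha'r, ha'pol,
    s, ψ, c, hc, hanti, hsq, hr, hEnd, hsimple,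
    fun x hx => antiCompatibleAnchor_of_chart_of_anticomm hn hd0 (hY s).1 hΨs hanti hsq hc (ε s) hx⟩

/-! ## §3 The first non-split sixfold cell `(ℚ(√-3), 6, [-2])`, `D₆ = (-3, 2)_ℚ` -/

/-- **THE FIRST CELL: its generic simple type-II member `(End⁰ ≃ₐ (-3, 2)_ℚ)` is an anchored fibre of Deligne's family,
MODULO J1** — §2 spelled out over `exists_simple_generic_fibre_firstSixfoldCell_of_periodConstructionAtWeilType` (p484441):
through every member `(P, ψ₀, h_K)` of Weil type `(3, 3)` over `ℚ(√-3)` with a non-degenerate discriminant witness of class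
`[-2]`, Deligne's family has a fibre `𝒳_s ≅ Y_s`, `Y_s` SIMPLE with `End⁰(Y_s) ≃ₐ[ℚ] (-3, 2)_ℚ`, `ψ² = 2r²·𝟙`,
`Ψ_s ψ = -ψ Ψ_s`, at which every class restricting into `weilClassesOf Y_s Ψ_s 3 3` is `antiCompatibleAnchor 3 3 𝒳_s`-anchored
— the anchor predicate of the registered stubs `stub_rung_firstCell_typeII{Pointed,Germ}`.
[cite: Deligne1982HodgeCycles, §4 Prop. 4.4 and proof of Thm. 4.8] [cite: Shimura1963AnalyticFamilies, §4 (Type II)]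
[cite: vanGeemenVerra2003QuaternionicPryms, §4 (abelian sixfolds with D₆)] [cite: MoonenZarhin1998WeilClasses, §2] -/
theorem exists_simple_generic_anchoredFibre_firstSixfoldCell_of_periodConstructionAtWeilType
    (hJ : deligne1982_weilFamily_periodConstructionAtWeilType)
    {P : AbelianVariety ℂ} {ψ₀ : P ⟶ P} (hWT : IsWeilType P ψ₀ 3 3)
    (e : ProjectiveEmbedding P.X) {a : complexBetti (projectiveSpace e.n ℂ) 2}
    (ha : IsRationalClass a) (ha0 : a ≠ 0) (u : ℚˣ) (hu2 : (u : ℚ) = -2)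
    (hδP : HasWeilDiscriminantNondeg P ψ₀ 3 3
      (((3 : ℕ) : ℂ) • complexBetti.map e.ι 2 a + complexBetti.map ψ₀.hom.hom.hom 2 (complexBetti.map e.ι 2 a))
      (QuotientGroup.mk u)) :
    ∃ (𝒳 S : SchemeOver ℂ) (f : 𝒳 ⟶ S) (g : 𝒳 ⟶ 𝒳) (s₀ : ComplexPoints S)
      (e' : P.X ≅ fiberOver f s₀)
      (Y : ComplexPoints S → AbelianVariety ℂ) (Ψ : ∀ s, Y s ⟶ Y s)
      (ε : ∀ s, (Y s).X ≅ fiberOver f s) (N : ℕ)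
      (ι : 𝒳 ⟶ CategoryTheory.MonoidalCategoryStruct.tensorObj (projectiveSpace N ℂ) S)
      (a' : complexBetti (projectiveSpace N ℂ) 2),
      IsSmoothProjectiveFamily f (2 * 3) ∧
      AlgebraicGeometry.IsClosedImmersion ι.left ∧
      ι ≫ CategoryTheory.CartesianMonoidalCategory.snd (projectiveSpace N ℂ) S = f ∧
      IrreducibleSpace S.left ∧ AlgebraicGeometry.Smooth S.hom ∧ IsQuasiProjectiveOver S ∧
      g ≫ f = f ∧
      (e'.hom ≫ fiberι f s₀) ≫ g = ψ₀.hom.hom.hom ≫ (e'.hom ≫ fiberι f s₀) ∧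
      (∀ s, (Y s).dim = 2 * 3 ∧ Ψ s ≫ Ψ s = -(((3 : ℕ) : ℤ) • 𝟙 (Y s)) ∧
        ((ε s).hom ≫ fiberι f s) ≫ g = (Ψ s).hom.hom.hom ≫ ((ε s).hom ≫ fiberι f s)) ∧
      IsRationalClass a' ∧
      complexBetti.map e'.hom 2 (complexBetti.map (fiberι f s₀) 2
        (complexBetti.map
          (ι ≫ CategoryTheory.CartesianMonoidalCategory.fst (projectiveSpace N ℂ) S) 2 a')) =
        ((3 : ℕ) : ℂ) • complexBetti.map e.ι 2 a +
          complexBetti.map ψ₀.hom.hom.hom 2 (complexBetti.map e.ι 2 a) ∧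
      ∃ (s : ComplexPoints S) (ψ : Y s ⟶ Y s) (c : ℕ), 0 < c ∧ Ψ s ≫ ψ = -(ψ ≫ Ψ s) ∧
        ψ ≫ ψ = c • 𝟙 (Y s) ∧ (∃ r : ℚ, r ≠ 0 ∧ (c : ℚ) = r ^ 2 * 2) ∧
        Nonempty ((Y s).endAlgebra ≃ₐ[ℚ] ℍ[ℚ,-3,2]) ∧ AbelianVariety.IsSimple (Y s) ∧
        ∀ x : complexBetti (fiberOver f s) (2 * 3),
          complexBetti.map (ε s).hom (2 * 3) x ∈ weilClassesOf (Y s) (Ψ s) 3 3 →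
            antiCompatibleAnchor 3 3 (fiberOver f s) x := by
  obtain ⟨𝒳, S, f, g, s₀, e', Y, Ψ, ε, N, ι, a', hfam, hιcl, hιf, hirr, hsm, hqp, hgf, hge', hY, ha'r, ha'pol,
    s, ψ, c, hc, hanti, hsq, hr, hEnd, hsimple⟩ :=
    exists_simple_generic_fibre_firstSixfoldCell_of_periodConstructionAtWeilType hJ hWT e ha ha0 u hu2 hδP
  have hΨs : Ψ s ≫ Ψ s = -((3 : ℕ) • 𝟙 (Y s)) := by rw [(hY s).2.1, natCast_zsmul]
  exact ⟨𝒳, S, f, g, s₀, e', Y, Ψ, ε, N, ι, a', hfam, hιcl, hιf, hirr, hsm, hqp, hgf, hge', hY, ha'r, ha'pol,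
    s, ψ, c, hc, hanti, hsq, hr, hEnd, hsimple,
    fun x hx => antiCompatibleAnchor_of_chart_of_anticomm (by norm_num) (by norm_num) (hY s).1 hΨs hanti hsq hc
      (ε s) hx⟩

end Summit.HodgeConjecture.HodgeConjecture.Theorems.SplitImpliesAllTypeIIGenericAnchor
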